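import Summits.CriticalPhenomena.SAWScalingLimit.Theorems.SAWTotalPositivityTPToTraversalBoundExitMassDefs
import Summits.CriticalPhenomena.SAWScalingLimit.Theorems.SAWTotalPositivityTPToTraversalBoundCriticalExitMassAux

/-!
# The critical exit mass `1 ≤ x_c · Σ_y e(y) Z_{Ω_δ}(p, y)` — stub `criticalExitMass`

Line `exit-mass-unforced-dive` of the crux `SAWTotalPositivity.TPToTraversalBound`
(stmt-CriticalPhenomena-10687).  This file proves the registered stub
`criticalExitMass : CriticalExitMass` (vocabulary `exteriorDegree`, `CriticalExitMass` in
`…TPToTraversalBoundExitMassDefs.lean`): for every bounded `Ω ⊆ ℂ`, mesh `δ > 0` and site `p`,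
`1 ≤ x_c · Σ_y e(y) · Z_{Ω_δ}(p, y)`, where `Z_{Ω_δ}(p, y) = SAW.weight Ω δ p y univ` is the critical
two-point partition function of the lattice domain `Ω_δ = discreteDomainGraph Ω δ` and
`e(y) = exteriorDegree Ω δ y` the number of `ℤ²`-edges at `y` that are not edges of `Ω_δ` — the
Lieb–Simon finite-size criterion read at `x_c` (the first critical LOWER bound of the line).

## Proof

The combinatorial core is the first-exit inequality `firstExit_sum_le` of
`…TPToTraversalBoundCriticalExitMassAux.lean`: for the finite set `D` of self-avoiding walk LISTS of
`Ω_δ` from `p` (it is finite because all sites but the first lie in the finite set `Ω_δ`,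
`exists_domFinset`) and every `N`,
`S_N ≤ C + x_c E S_N` with `S_N = Σ_{n ≤ N} cₙ x_cⁿ ≥ N + 1`, `C = Σ_{γ ∈ D} x_c^{|γ|}`,
`E = Σ_{γ ∈ D} e(end γ) x_c^{|γ|}`.  Hence `1 ≤ x_c E` (`one_le_exitSum`: otherwise
`(N + 1)(1 - x_c E) ≤ C` for all `N`), and `E ≤ Σ_y e(y) Z_{Ω_δ}(p, y)` in `ℝ≥0∞` because `D` injects
into `Σ y, SAW.DomainSAW Ω δ p y` by `list ↦ (last site, SimpleGraph.Walk.ofSupport list)`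
(`ofReal_exitSum_le`).

Sources: B. Simon, *Correlation inequalities and the decay of correlations in ferromagnets*, Commun.
Math. Phys. 77 (1980) 111–126; E. H. Lieb, *A refinement of Simon's correlation inequality*, ibid.
127–135 (finite-size criteria, read contrapositively at the critical point); N. Madras, G. Slade,
*The Self-Avoiding Walk* (1993), §1.2 (`μⁿ ≤ cₙ`, splitting of walks).
Deliberately NOT here: anything about the other stubs of the line (dives, traversals); no definitions.
-/

noncomputable section

open MeasureTheory
open scoped NNReal ENNReal BigOperators
open Literature.Probability.LatticeModels
open Literature.Probability.RandomPlanarGeometry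
open Summit.CriticalPhenomena.SAWScalingLimit.Theses.SAWTotalPositivity

namespace Summit.CriticalPhenomena.SAWScalingLimit.Theorems.TPToTraversalBound.ExitMass

variable {Ω : Set ℂ} {δ : ℝ}

/-! ## The self-avoiding walk lists of `Ω_δ` from a site form a finite set -/

/-- Every site after the first of a walk list of `Ω_δ` is a vertex of `Ω_δ`. [folklore] -/
private theorem mem_meshDomain_of_isChain : ∀ (a : Site 2) (t : List (Site 2)),
    (a :: t).IsChain (discreteDomainGraph Ω δ).Adj → ∀ y ∈ t, y ∈ meshDomain Ω δ
  | _, [], _ => by simp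
  | a, b :: t, h => by
    rw [List.isChain_cons_cons] at h
    intro y hy
    rcases List.mem_cons.1 hy with rfl | hy
    · exact (discreteDomainGraph_adj_iff.1 h.1).2.2
    · exact mem_meshDomain_of_isChain b t h.2 y hy

/-- A self-avoiding walk list of `Ω_δ` has at most `#Ω_δ + 1` sites (all but the first lie in the
finite set `Ω_δ`, without repetition). [folklore] -/
private theorem length_le_of_isChain (hD : (meshDomain Ω δ).Finite) {l : List (Site 2)}
    (hsaw : SAW.Zd.IsSAW 2 l) (hG : l.IsChain (discreteDomainGraph Ω δ).Adj) :
    l.length ≤ (meshDomain Ω δ).ncard + 1 := by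
  classical
  obtain ⟨a, t, rfl⟩ := List.exists_cons_of_ne_nil hsaw.ne_nil
  have ht : ∀ y ∈ t, y ∈ meshDomain Ω δ := mem_meshDomain_of_isChain a t hG
  have hnd : t.Nodup := (List.nodup_cons.1 hsaw.nodup).2
  have : t.length ≤ (meshDomain Ω δ).ncard := by
    rw [← List.toFinset_card_of_nodup hnd, Set.ncard_eq_toFinset_card _ hD]
    exact Finset.card_le_card fun y hy => hD.mem_toFinset.2 (ht y (List.mem_toFinset.1 hy))
  rw [List.length_cons]; omega

/-- For bounded `Ω` and `δ > 0` (so that `Ω_δ` is finite) the self-avoiding walk lists of `Ω_δ` from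
`p` — non-empty, nearest-neighbour, without repeated site, starting at `p`, every step an edge of
`Ω_δ` — form a finite set `D`. [folklore] -/
private theorem exists_domFinset (hD : (meshDomain Ω δ).Finite) (p : Site 2) :
    ∃ D : Finset (List (Site 2)), ∀ l : List (Site 2),
      l ∈ D ↔ SAW.Zd.IsSAW 2 l ∧ l.head? = some p ∧ l.IsChain (discreteDomainGraph Ω δ).Adj := by
  classical
  obtain ⟨F, hF⟩ := exists_finset_saws (meshDomain Ω δ).ncard p
  refine ⟨F.filter fun l => l.IsChain (discreteDomainGraph Ω δ).Adj, fun l => ?_⟩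
  rw [Finset.mem_filter, hF]
  constructor
  · rintro ⟨⟨h1, h2, -⟩, h3⟩
    exact ⟨h1, h2, h3⟩
  · rintro ⟨h1, h2, h3⟩
    exact ⟨⟨h1, h2, length_le_of_isChain hD h1 h3⟩, h3⟩

/-! ## The real inequality `1 ≤ x_c · E` -/

/-- **The exit functional at `x_c` is at least `1`** (real form): with `D` the set of self-avoiding
walk lists of `Ω_δ` from `p` and `E = Σ_{γ ∈ D} e(end γ) x_c^{|γ|}`, `1 ≤ x_c E`.  Otherwise the
first-exit inequality (`firstExit_sum_le`) with `C = Σ_{γ ∈ D} x_c^{|γ|}` and `S_N ≥ N + 1`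
(`succ_le_sum_count_mul_pow`) give `(N + 1)(1 - x_c E) ≤ S_N (1 - x_c E) ≤ C` for every `N`, absurd.
(Simon 1980 / Lieb 1980, contrapositive.) [cite: MadrasSlade1993, §1.2] -/
private theorem one_le_exitSum (p : Site 2) (D : Finset (List (Site 2)))
    (hmem : ∀ l : List (Site 2),
      l ∈ D ↔ SAW.Zd.IsSAW 2 l ∧ l.head? = some p ∧ l.IsChain (discreteDomainGraph Ω δ).Adj) :
    1 ≤ SAW.criticalFugacity * ∑ γ ∈ D,
        (exteriorDegree Ω δ (γ.getLast?.getD 0) : ℝ) * SAW.criticalFugacity ^ (γ.length - 1) := by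
  set G := discreteDomainGraph Ω δ
  set x := SAW.criticalFugacity
  have hx : 0 ≤ x := SAW.criticalFugacity_pos_lt_one'.1.le
  set C := ∑ γ ∈ D, x ^ (γ.length - 1)
  set E := ∑ γ ∈ D, (exteriorDegree Ω δ (γ.getLast?.getD 0) : ℝ) * x ^ (γ.length - 1)
  have hDall : ∀ l : List (Site 2), SAW.Zd.IsSAW 2 l → l.head? = some p → l.IsChain G.Adj → l ∈ D :=
    fun l h1 h2 h3 => (hmem l).2 ⟨h1, h2, h3⟩
  by_contra hlt
  rw [not_le] at hlt
  have key : ∀ N : ℕ, ((N : ℝ) + 1) * (1 - x * E) ≤ C := by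
    intro N
    set S := ∑ n ∈ Finset.range (N + 1), (SAW.Zd.count 2 n : ℝ) * x ^ n
    have hS1 : (N : ℝ) + 1 ≤ S := succ_le_sum_count_mul_pow N
    have h1 : S ≤ C + x * E * S := firstExit_sum_le G p D hDall x hx N
    have h3 : S * (1 - x * E) = S - x * E * S := by ring
    calc ((N : ℝ) + 1) * (1 - x * E) ≤ S * (1 - x * E) :=
          mul_le_mul_of_nonneg_right hS1 (by linarith)
      _ ≤ C := by rw [h3]; linarith
  have hpos : 0 < 1 - x * E := by linarith
  obtain ⟨N, hN⟩ := exists_nat_gt (C / (1 - x * E))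
  have := key N
  rw [← le_div_iff₀ hpos] at this
  linarith

/-! ## Passage to `ℝ≥0∞` and the stub -/

/-- `Z_{Ω_δ}(p, y) = Σ_γ x_c^{|γ|}` as a `tsum` over `SAW.DomainSAW Ω δ p y`. [folklore] -/
private theorem weight_univ_eq (p y : Site 2) :
    SAW.weight Ω δ p y Set.univ =
      ∑' γ : SAW.DomainSAW Ω δ p y, ENNReal.ofReal (SAW.criticalFugacity ^ γ.length) := by
  rw [SAW.weight, Measure.sum_apply _ MeasurableSpace.measurableSet_top]
  simp only [Measure.smul_apply, smul_eq_mul, measure_univ, mul_one]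

/-- **Passage to `ℝ≥0∞`**: the self-avoiding walk lists of `Ω_δ` from `p` inject into
`Σ y, SAW.DomainSAW Ω δ p y` (`list ↦ (last site, SimpleGraph.Walk.ofSupport list)`), so
`E ≤ Σ_y e(y) Z_{Ω_δ}(p, y)`. [folklore] -/
private theorem ofReal_exitSum_le (p : Site 2) (D : Finset (List (Site 2)))
    (hmem : ∀ l : List (Site 2),
      l ∈ D ↔ SAW.Zd.IsSAW 2 l ∧ l.head? = some p ∧ l.IsChain (discreteDomainGraph Ω δ).Adj) :
    ENNReal.ofReal (∑ γ ∈ D,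
        (exteriorDegree Ω δ (γ.getLast?.getD 0) : ℝ) * SAW.criticalFugacity ^ (γ.length - 1)) ≤
      ∑' y : Site 2, (exteriorDegree Ω δ y : ℝ≥0∞) * SAW.weight Ω δ p y Set.univ := by
  set G := discreteDomainGraph Ω δ
  set x := SAW.criticalFugacity
  have hx : 0 ≤ x := SAW.criticalFugacity_pos_lt_one'.1.le
  have hL : ENNReal.ofReal (∑ γ ∈ D, (exteriorDegree Ω δ (γ.getLast?.getD 0) : ℝ) *
      x ^ (γ.length - 1)) = ∑ γ ∈ D, (exteriorDegree Ω δ (γ.getLast?.getD 0) : ℝ≥0∞) *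
        ENNReal.ofReal (x ^ (γ.length - 1)) := by
    rw [ENNReal.ofReal_sum_of_nonneg fun γ _ => mul_nonneg (Nat.cast_nonneg _) (pow_nonneg hx _)]
    refine Finset.sum_congr rfl fun γ _ => ?_
    rw [ENNReal.ofReal_mul (Nat.cast_nonneg _), ENNReal.ofReal_natCast]
  have hR : ∑' y : Site 2, (exteriorDegree Ω δ y : ℝ≥0∞) * SAW.weight Ω δ p y Set.univ =
      ∑' s : Σ y, SAW.DomainSAW Ω δ p y,
        (exteriorDegree Ω δ s.1 : ℝ≥0∞) * ENNReal.ofReal (x ^ s.2.length) := by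
    rw [ENNReal.tsum_sigma'
      (fun s : Σ y, SAW.DomainSAW Ω δ p y =>
        (exteriorDegree Ω δ s.1 : ℝ≥0∞) * ENNReal.ofReal (x ^ s.2.length))]
    exact tsum_congr fun y => by rw [weight_univ_eq, ← ENNReal.tsum_mul_left]
  rw [hL, hR, ← Finset.tsum_subtype]
  have hmem' : ∀ l ∈ D, l ≠ [] ∧ l.IsChain G.Adj ∧ l.Nodup ∧ l.head? = some p := fun l hl => by
    obtain ⟨hsaw, hhead, hG⟩ := (hmem l).1 hl
    exact ⟨hsaw.ne_nil, hG, hsaw.nodup, hhead⟩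
  have hh : ∀ l : {l // l ∈ D}, l.1.head (hmem' l.1 l.2).1 = p := fun l =>
    (List.head_eq_iff_head?_eq_some _).2 (hmem' l.1 l.2).2.2.2
  -- the injection `list ↦ (last site, the walk of `Ω_δ` with this vertex list)`
  refine le_trans (le_of_eq ?_) (ENNReal.tsum_comp_le_tsum_of_injective
    (f := fun l : {l // l ∈ D} => (⟨l.1.getLast (hmem' l.1 l.2).1,
      ⟨(SimpleGraph.Walk.ofSupport l.1 (hmem' l.1 l.2).1 (hmem' l.1 l.2).2.1).copy (hh l) rfl,
        (SimpleGraph.Walk.isPath_def _).2 (by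
          rw [SimpleGraph.Walk.support_copy, SimpleGraph.Walk.support_ofSupport]
          exact (hmem' l.1 l.2).2.2.1)⟩⟩ : Σ y, SAW.DomainSAW Ω δ p y)) ?_ _)
  · refine tsum_congr fun l => ?_
    simp only [SAW.DomainSAW.length, SimpleGraph.Walk.length_copy,
      SimpleGraph.Walk.length_ofSupport]
    rw [List.getLast?_eq_some_getLast (hmem' l.1 l.2).1, Option.getD_some]
  · intro l₁ l₂ h
    have h' := congrArg (fun s : Σ y, SAW.DomainSAW Ω δ p y => s.2.walk.support) h
    simp only [SimpleGraph.Walk.support_copy, SimpleGraph.Walk.support_ofSupport] at h'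
    exact Subtype.ext h'

/-- **CriticalExitMass — the Lieb–Simon criterion read at `x_c`** (registered stub
`stub_criticalExitMass` of the line `exit-mass-unforced-dive`, crux `TPToTraversalBound`): for every
bounded `Ω ⊆ ℂ`, mesh `δ > 0` and site `p`,
`1 ≤ x_c · Σ_y e(y) · Z_{Ω_δ}(p, y)` with `Z_{Ω_δ}(p, y) = SAW.weight Ω δ p y univ` and
`e(y) = exteriorDegree Ω δ y`.  If it failed, the first-exit decomposition of the self-avoiding walks of
`ℤ²` from `p` would bound `Σ_{n ≤ N} cₙ x_cⁿ` uniformly in `N`, contradicting `cₙ x_cⁿ ≥ 1`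
(B. Simon, Commun. Math. Phys. 77 (1980) 111–126 and E. H. Lieb, ibid. 127–135, read contrapositively;
Madras–Slade 1993 §1.2). [cite: MadrasSlade1993, §1.2] -/
theorem criticalExitMass : CriticalExitMass := by
  intro Ω δ p hΩ hδ
  obtain ⟨D, hD⟩ := exists_domFinset (meshDomain_finite hΩ hδ) p
  have h1 := one_le_exitSum p D hD
  have hx : 0 ≤ SAW.criticalFugacity := SAW.criticalFugacity_pos_lt_one'.1.le
  calc (1 : ℝ≥0∞) = ENNReal.ofReal 1 := ENNReal.ofReal_one.symm
    _ ≤ _ := ENNReal.ofReal_le_ofReal h1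
    _ = ENNReal.ofReal SAW.criticalFugacity * _ := ENNReal.ofReal_mul hx
    _ ≤ _ := mul_le_mul_right (ofReal_exitSum_le p D hD) _

end Summit.CriticalPhenomena.SAWScalingLimit.Theorems.TPToTraversalBound.ExitMass

end
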